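/-
Literature anchor (engines lane eng-sdp-1, idle-priority Lean literature lane).
Source: V. Berinde, *Iterative Approximation of Fixed Points*, Lecture Notes in Mathematics 1912,
Springer 2007, Chapter 4 §4.3 (strongly pseudocontractive operators: Theorem 4.11, Corollary 4.2,
Example 4.3, Theorem 4.12, Corollary 4.3), with the equivalent forms (12), (12'), (12'') of strong
pseudocontractivity from Chapter 1 (Definition 1.13, Remarks), the recurrent-inequality
Lemma 1.2, and Chapter 9 §9.5 Theorem 9.8 (the fastest Krasnoselskij iteration).  [cite: Berinde2007]
-/
import Mathlib
import HarnessLib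
import Literature.Analysis.Convex.KrasnoselskijIteration

/-!
# Mann iteration for Lipschitzian strongly pseudocontractive operators (Berinde 2007, Ch. 4 §4.3)

Let `E` be a real normed space, `K ⊆ E` convex, `T : E → E` with `T(K) ⊆ K`.  `T` is **strongly
pseudocontractive** on `K` with constant `k` if (Berinde's (12''), the Kato form of (12'))

  `‖x − y‖ ≤ ‖x − y + r [(I − T − kI) x − (I − T − kI) y]‖`  for all `x, y ∈ K`, `r > 0`.

The **Mann iteration** is `x_{n+1} = (1 − α_n) x_n + α_n T x_n` ((5)/(13)).

Main results formalised (all in an arbitrary real normed space, norm-only proofs as in the book):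

* `norm_mannStep_sub_le_spc` — the one-step estimate behind (14)/(15)/(17): if `T` is
  `L`-Lipschitzian and `k`-strongly pseudocontractive on `K`, `p = T p ∈ K`, `x ∈ K`, `0 < a ≤ 1`,
  then `(1 + a) ‖x⁺ − p‖ ≤ (1 + (1 − k) a + (L + 1)(L + 2 − k) a²) ‖x − p‖`, obtained from the
  algebraic identity `mann_identity_spc` and (12'') applied at `(x⁺, p)` with `r = a/(1+a)`;
* `tendsto_mannIter_spc` — **Theorem 4.12** (Berinde): `α_n ∈ (0,1]`, `Σ α_n = ∞`,
  `α_n ≤ (k − η)/((L+1)(L+2−k))` ⟹ `x_n → p`, with the estimate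
  `‖x_n − p‖ ≤ ∏_{j<n} (A_j/B_j) ‖x_0 − p‖` (`norm_mannIter_sub_le_prod_spc`) and
  `1 − A_j/B_j ≥ (η/(1+k)) α_j` (`spcFactor_le_one_sub`);
* `tendsto_mannIter_spc_of_tendsto_zero` — **Theorem 4.11**: `α_n ∈ (0,1]`, `Σ α_n = ∞`, `α_n → 0`
  ⟹ `x_n → p` (boundedness of `K` is not needed, as Berinde remarks before Theorem 4.12);
* `norm_mannIter_sub_le_pow_cor42` — **Corollary 4.2**: `α_n ≡ k/(2(3+3L+L²))` gives the linear rate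
  `ρ = 1 − k²/(4(3+3L+L²))`;
* `norm_mannIter_sub_le_pow_cor43`, `tendsto_mannIter_cor43` — **Corollary 4.3** (Krasnoselskij
  iteration, `λ < k/((L+1)(L+2−k))`, rate `q = A/B < 1`);
* `spcFactor_sub_spcFactor_optimal`, `spcFactor_optimal_lt`, `tendsto_pow_spcFactor_optimal_div` —
  **Theorem 9.8** (Ch. 9 §9.5, the fastest Krasnoselskij iteration): with `C = (L+1)(L+2−k)`,
  `q(λ) − q(λ₀) = C(λ − λ₀)²/(1 + λ)` for `λ₀ = −1 + √(1 + k/C) ∈ (0, k/C)` (`spcOptimalStep`), so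
  `λ₀` uniquely minimises the factor and `(q(λ₀)/q(λ))ⁿ → 0` for `λ ≠ λ₀`;
* `IsStrongPseudocontractiveOn.fixedPoint_unique` — uniqueness of the fixed point;
* `isStrongPseudocontractiveOn_iff_form12` — (12'') ⟺ Berinde's (12) with `t = 1/(1−k)`;
* `isStrongPseudocontractiveOn_iff_inner` — in a real inner product space (12'') ⟺ (12')
  `⟪(I−T)x − (I−T)y, x − y⟫ ≥ k ‖x − y‖²` (Kato's lemma in Hilbert space,
  `norm_le_norm_add_smul_iff_inner_nonneg`);
* `example43_isStrongPseudocontractiveOn` — **Example 4.3 (b)**: `T x = 1/x` on `[1/2, 2]` is strongly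
  pseudocontractive with every constant `k ≤ 1`;
* `mannIter_const_eq_kmIter` — dictionary: with a constant sequence the Mann iteration is the tree's
  Krasnoselskij iteration `KrasnoselskijIteration.kmIter`.

Conventions / declared deviations: indices start at `0` (`x_0 = x₀`, so Berinde's `ρⁿ ‖x_1 − p‖`
reads `ρ^n ‖x_0 − p‖`); `T : E → E` with `MapsTo T K K` and all hypotheses restricted to `K`;
closedness of `K` and completeness of `E` are not needed for these statements (the limit `p` is the
given fixed point); the recurrent-inequality step (Lemma 1.2) is proved here in the form
`δ_{n+1} ≤ (1 − c a_n) δ_n, Σ a_n = ∞ ⟹ δ_n ≤ δ_0 exp(−c Σ_{j<n} a_j) → 0`.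
-/

namespace Literature.Analysis.Convex.MannStrongPseudocontractions

open Filter Topology Set Function Finset
open scoped RealInnerProductSpace
open Literature.Analysis.Convex.KrasnoselskijIteration (averagedMap kmIter kmIter_succ)

section Normed

variable {E : Type*} [NormedAddCommGroup E] [NormedSpace ℝ E]
variable {T : E → E} {K : Set E} {α : ℕ → ℝ} {x₀ x y p q : E} {k L a η t : ℝ}

/-! ## The Mann iteration -/

/-- One Mann step `x ↦ (1 − a) x + a T x` ((5), (13)). [cite: Berinde2007, Ch. 4 §4.3 (13)] -/
def mannStep (T : E → E) (a : ℝ) (x : E) : E := (1 - a) • x + a • T x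

/-- The **Mann iteration** `x_{n+1} = (1 − α_n) x_n + α_n T x_n`, `x_0 = x₀` ((5), (13)).
[cite: Berinde2007, Ch. 4 §4.3 (13)] -/
def mannIter (T : E → E) (α : ℕ → ℝ) (x₀ : E) : ℕ → E
  | 0 => x₀
  | n + 1 => mannStep T (α n) (mannIter T α x₀ n)

/-- `x_0 = x₀`. [cite: Berinde2007, Ch. 4 §4.3 (13)] -/
@[simp] theorem mannIter_zero : mannIter T α x₀ 0 = x₀ := rfl

/-- `x_{n+1} = (1 − α_n) x_n + α_n T x_n`. [cite: Berinde2007, Ch. 4 §4.3 (13)] -/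
theorem mannIter_succ (n : ℕ) :
    mannIter T α x₀ (n + 1) = mannStep T (α n) (mannIter T α x₀ n) := rfl

/-- `x⁺ − x = a (T x − x)`. [cite: Berinde2007, Ch. 4 §4.3 (13)] -/
theorem mannStep_sub_self (T : E → E) (a : ℝ) (x : E) :
    mannStep T a x - x = a • (T x - x) := by
  simp only [mannStep]
  module

/-- A fixed point of `T` is fixed by every Mann step. [cite: Berinde2007, Ch. 4 §4.3 (13)] -/
theorem mannStep_eq_self_of_eq (hp : T p = p) (a : ℝ) : mannStep T a p = p := by
  rw [← sub_eq_zero, mannStep_sub_self, hp, sub_self, smul_zero]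

/-- The Mann step stays in a convex `T`-invariant set for `0 ≤ a ≤ 1`.
[cite: Berinde2007, Ch. 4 §4.3, Thm. 4.11] -/
theorem mannStep_mem (hK : Convex ℝ K) (hTK : MapsTo T K K) (hx : x ∈ K) (ha0 : 0 ≤ a)
    (ha1 : a ≤ 1) : mannStep T a x ∈ K :=
  hK hx (hTK hx) (sub_nonneg.2 ha1) ha0 (sub_add_cancel 1 a)

/-- The Mann iteration stays in `K` ("`{x_n} ⊂ K`"). [cite: Berinde2007, Ch. 4 §4.3, Thm. 4.11] -/
theorem mannIter_mem (hK : Convex ℝ K) (hTK : MapsTo T K K) (hx₀ : x₀ ∈ K)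
    (hα : ∀ n, 0 ≤ α n ∧ α n ≤ 1) (n : ℕ) : mannIter T α x₀ n ∈ K := by
  induction n with
  | zero => exact hx₀
  | succ n ih => exact mannStep_mem hK hTK ih (hα n).1 (hα n).2

/-! ## Strong pseudocontractivity in the Kato form (12'') -/

/-- `T` is **strongly pseudocontractive on `K` with constant `k`** in the norm form (12''):
`‖x − y‖ ≤ ‖x − y + r [(I − T − kI) x − (I − T − kI) y]‖` for all `x, y ∈ K` and `r > 0`, where
`(I − T − kI) z = (1 − k) z − T z`. [cite: Berinde2007, Ch. 4 §4.3 (12''); Ch. 1 Def. 1.13 Rem. 2] -/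
def IsStrongPseudocontractiveOn (k : ℝ) (T : E → E) (K : Set E) : Prop :=
  ∀ ⦃x⦄, x ∈ K → ∀ ⦃y⦄, y ∈ K → ∀ ⦃r : ℝ⦄, 0 < r →
    ‖x - y‖ ≤ ‖(x - y) + r • (((1 - k) • x - T x) - ((1 - k) • y - T y))‖

/-- (12'') is Berinde's (12) `‖x − y‖ ≤ ‖(1 + r)(x − y) − r t (T x − T y)‖` (`r > 0`) with
`t = 1/(1 − k)`, i.e. `k = (t − 1)/t` (reparametrise `r ↦ r t`). [cite: Berinde2007, Ch. 4 §4.3 (12)] -/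
theorem isStrongPseudocontractiveOn_iff_form12 (hk : k < 1) :
    IsStrongPseudocontractiveOn k T K ↔ ∀ ⦃x⦄, x ∈ K → ∀ ⦃y⦄, y ∈ K → ∀ ⦃r : ℝ⦄, 0 < r →
      ‖x - y‖ ≤ ‖(1 + r) • (x - y) - (r / (1 - k)) • (T x - T y)‖ := by
  have hk' : 0 < 1 - k := sub_pos.2 hk
  have key : ∀ (x y : E) (s : ℝ), (x - y) + s • (((1 - k) • x - T x) - ((1 - k) • y - T y))
      = (1 + s * (1 - k)) • (x - y) - s • (T x - T y) := by
    intro x y s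
    module
  constructor
  · intro h x hx y hy r hr
    have h1 := h hx hy (div_pos hr hk')
    rw [key, div_mul_cancel₀ r hk'.ne'] at h1
    exact h1
  · intro h x hx y hy r hr
    have h1 := h hx hy (mul_pos hr hk')
    rw [key]
    rw [mul_div_cancel_right₀ r hk'.ne'] at h1
    exact h1

/-- A strongly pseudocontractive operator (`k > 0`) has at most one fixed point in `K`
("the unique fixed point of `T`"). [cite: Berinde2007, Ch. 4 §4.3, Thm. 4.11] -/
theorem IsStrongPseudocontractiveOn.fixedPoint_unique (h : IsStrongPseudocontractiveOn k T K)
    (hk : 0 < k) (hp : p ∈ K) (hq : q ∈ K) (hTp : T p = p) (hTq : T q = q) : p = q := by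
  have h1 := h hp hq (one_div_pos.2 hk)
  have e : (p - q) + (1 / k) • (((1 - k) • p - T p) - ((1 - k) • q - T q))
      = (1 - 1 / k * k) • (p - q) := by
    rw [hTp, hTq]
    module
  rw [e, show 1 - 1 / k * k = (0 : ℝ) by field_simp; ring, zero_smul, norm_zero,
    norm_le_zero_iff, sub_eq_zero] at h1
  exact h1

/-! ## The one-step estimate (14)–(17) -/

omit [NormedSpace ℝ E] in
/-- (16): for an `L`-Lipschitzian `T` with fixed point `p`, `‖x − T x‖ ≤ (1 + L) ‖x − p‖`.
[cite: Berinde2007, Ch. 4 §4.3, Thm. 4.12 (16)] -/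
theorem norm_sub_apply_le_spc (h3 : ∀ ⦃x⦄, x ∈ K → ∀ ⦃y⦄, y ∈ K → ‖T x - T y‖ ≤ L * ‖x - y‖)
    (hx : x ∈ K) (hp : p ∈ K) (hTp : T p = p) : ‖x - T x‖ ≤ (1 + L) * ‖x - p‖ := by
  have h1 : ‖T p - T x‖ ≤ L * ‖p - x‖ := h3 hp hx
  rw [hTp, norm_sub_rev p x] at h1
  calc ‖x - T x‖ = ‖(x - p) + (p - T x)‖ := by rw [sub_add_sub_cancel]
    _ ≤ ‖x - p‖ + ‖p - T x‖ := norm_add_le _ _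
    _ ≤ ‖x - p‖ + L * ‖x - p‖ := by linarith
    _ = (1 + L) * ‖x - p‖ := by ring

/-- The algebraic identity of the proof of Theorem 4.11: with `x⁺ = (1 − a) x + a T x` and `T p = p`,
`x − p = (1 + a)(x⁺ − p) + a [(I − T − kI) x⁺ − (I − T − kI) p] − (1 − k) a (x − p)
 + (2 − k) a² (x − T x) + a (T x⁺ − T x)`. [cite: Berinde2007, Ch. 4 §4.3, Thm. 4.11 (proof)] -/
theorem mann_identity_spc (hTp : T p = p) (a k : ℝ) (x : E) :
    x - p = (1 + a) • (mannStep T a x - p)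
      + a • (((1 - k) • mannStep T a x - T (mannStep T a x)) - ((1 - k) • p - T p))
      - ((1 - k) * a) • (x - p) + ((2 - k) * a ^ 2) • (x - T x)
      + a • (T (mannStep T a x) - T x) := by
  rw [hTp]
  generalize T (mannStep T a x) = w
  simp only [mannStep]
  module

/-- **The one-step estimate** ((14)/(15) combined with (16), i.e. (17) before dividing by
`B = 1 + a`): if `T` is `L`-Lipschitzian and `k`-strongly pseudocontractive on the convex
`T`-invariant set `K` (`k ≤ 1`, `L ≥ 0`), `p = T p ∈ K`, `x ∈ K` and `0 < a ≤ 1`, then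
`(1 + a) ‖x⁺ − p‖ ≤ (1 + (1 − k) a + (L + 1)(L + 2 − k) a²) ‖x − p‖`.
[cite: Berinde2007, Ch. 4 §4.3, Thm. 4.11 (14), Thm. 4.12 (15)–(17)] -/
theorem norm_mannStep_sub_le_spc (hK : Convex ℝ K) (hTK : MapsTo T K K)
    (h12 : IsStrongPseudocontractiveOn k T K)
    (h3 : ∀ ⦃x⦄, x ∈ K → ∀ ⦃y⦄, y ∈ K → ‖T x - T y‖ ≤ L * ‖x - y‖) (hL : 0 ≤ L) (hk1 : k ≤ 1)
    (hx : x ∈ K) (hp : p ∈ K) (hTp : T p = p) (ha0 : 0 < a) (ha1 : a ≤ 1) :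
    (1 + a) * ‖mannStep T a x - p‖
      ≤ (1 + (1 - k) * a + (L + 1) * (L + 2 - k) * a ^ 2) * ‖x - p‖ := by
  set x' := mannStep T a x with hx'def
  have hx' : x' ∈ K := mannStep_mem hK hTK hx ha0.le ha1
  have ha1' : 0 < 1 + a := by linarith
  -- (12'') at (x⁺, p) with r = a/(1+a), multiplied by 1 + a
  have h1 := h12 hx' hp (div_pos ha0 ha1')
  have h2 : (1 + a) * ‖x' - p‖
      ≤ ‖(1 + a) • (x' - p) + a • (((1 - k) • x' - T x') - ((1 - k) • p - T p))‖ := by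
    have e : (1 + a) • ((x' - p) + (a / (1 + a)) • (((1 - k) • x' - T x') - ((1 - k) • p - T p)))
        = (1 + a) • (x' - p) + a • (((1 - k) • x' - T x') - ((1 - k) • p - T p)) := by
      rw [smul_add, smul_smul, mul_div_cancel₀ a ha1'.ne']
    calc (1 + a) * ‖x' - p‖
        ≤ (1 + a) * ‖(x' - p) + (a / (1 + a)) • (((1 - k) • x' - T x') - ((1 - k) • p - T p))‖ :=
          mul_le_mul_of_nonneg_left h1 ha1'.le
      _ = ‖(1 + a) • ((x' - p)
            + (a / (1 + a)) • (((1 - k) • x' - T x') - ((1 - k) • p - T p)))‖ := by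
          rw [norm_smul, Real.norm_eq_abs, abs_of_pos ha1']
      _ = _ := by rw [e]
  -- the identity, rearranged
  have hid : (1 + a) • (x' - p) + a • (((1 - k) • x' - T x') - ((1 - k) • p - T p))
      = (x - p) + ((1 - k) * a) • (x - p) - ((2 - k) * a ^ 2) • (x - T x) - a • (T x' - T x) := by
    rw [hx'def, hTp]
    generalize T (mannStep T a x) = w
    simp only [mannStep]
    module
  have h3' : ‖(1 + a) • (x' - p) + a • (((1 - k) • x' - T x') - ((1 - k) • p - T p))‖
      ≤ ‖x - p‖ + (1 - k) * a * ‖x - p‖ + (2 - k) * a ^ 2 * ‖x - T x‖ + a * ‖T x' - T x‖ := by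
    rw [hid]
    have n1 : ‖((1 - k) * a) • (x - p)‖ = (1 - k) * a * ‖x - p‖ := by
      rw [norm_smul, Real.norm_eq_abs, abs_of_nonneg (by nlinarith)]
    have n2 : ‖((2 - k) * a ^ 2) • (x - T x)‖ = (2 - k) * a ^ 2 * ‖x - T x‖ := by
      rw [norm_smul, Real.norm_eq_abs, abs_of_nonneg (by nlinarith)]
    have n3 : ‖a • (T x' - T x)‖ = a * ‖T x' - T x‖ := by
      rw [norm_smul, Real.norm_eq_abs, abs_of_pos ha0]
    calc ‖(x - p) + ((1 - k) * a) • (x - p) - ((2 - k) * a ^ 2) • (x - T x) - a • (T x' - T x)‖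
        ≤ ‖(x - p) + ((1 - k) * a) • (x - p) - ((2 - k) * a ^ 2) • (x - T x)‖
            + ‖a • (T x' - T x)‖ := norm_sub_le _ _
      _ ≤ ‖(x - p) + ((1 - k) * a) • (x - p)‖ + ‖((2 - k) * a ^ 2) • (x - T x)‖
            + ‖a • (T x' - T x)‖ := by gcongr; exact norm_sub_le _ _
      _ ≤ ‖x - p‖ + ‖((1 - k) * a) • (x - p)‖ + ‖((2 - k) * a ^ 2) • (x - T x)‖
            + ‖a • (T x' - T x)‖ := by gcongr; exact norm_add_le _ _
      _ = _ := by rw [n1, n2, n3]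
  -- Lipschitz bounds
  have i1 : ‖x - T x‖ ≤ (1 + L) * ‖x - p‖ := norm_sub_apply_le_spc h3 hx hp hTp
  have i2 : ‖T x' - T x‖ ≤ L * a * (1 + L) * ‖x - p‖ := by
    calc ‖T x' - T x‖ ≤ L * ‖x' - x‖ := h3 hx' hx
      _ = L * (a * ‖x - T x‖) := by
          rw [hx'def, mannStep_sub_self, norm_smul, Real.norm_eq_abs, abs_of_pos ha0,
            norm_sub_rev]
      _ ≤ L * (a * ((1 + L) * ‖x - p‖)) := by gcongr
      _ = _ := by ring
  have j1 := mul_le_mul_of_nonneg_left i1 (show 0 ≤ (2 - k) * a ^ 2 by nlinarith)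
  have j2 := mul_le_mul_of_nonneg_left i2 ha0.le
  nlinarith [h2, h3', j1, j2]

/-- Berinde's contraction factor `A/B = (1 + (1 − k) a + (L + 1)(L + 2 − k) a²)/(1 + a)` of (17).
[cite: Berinde2007, Ch. 4 §4.3, Thm. 4.12 (17)] -/
noncomputable def spcFactor (k L a : ℝ) : ℝ := (1 + (1 - k) * a + (L + 1) * (L + 2 - k) * a ^ 2) / (1 + a)

/-- `A/B > 0` for `a ≥ 0`, `k ≤ 1`, `L ≥ 0`. [cite: Berinde2007, Ch. 4 §4.3, Thm. 4.12 (17)] -/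
theorem spcFactor_pos (hk1 : k ≤ 1) (hL : 0 ≤ L) (ha0 : 0 ≤ a) : 0 < spcFactor k L a := by
  unfold spcFactor
  apply div_pos _ (by linarith)
  have : 0 ≤ (L + 1) * (L + 2 - k) * a ^ 2 :=
    mul_nonneg (mul_nonneg (by linarith) (by linarith)) (sq_nonneg a)
  nlinarith

/-- `1 − A/B = a/(1+a) · [k − (L+1)(L+2−k) a]` (the computation of `β_n`).
[cite: Berinde2007, Ch. 4 §4.3, Thm. 4.12 (proof)] -/
theorem one_sub_spcFactor (ha : 0 ≤ a) :
    1 - spcFactor k L a = a / (1 + a) * (k - (L + 1) * (L + 2 - k) * a) := by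
  unfold spcFactor
  have : (1 + a) ≠ 0 := by positivity
  field_simp
  ring

/-- (17): `‖x⁺ − p‖ ≤ (A/B) ‖x − p‖`. [cite: Berinde2007, Ch. 4 §4.3, Thm. 4.12 (17)] -/
theorem norm_mannStep_sub_le_spcFactor (hK : Convex ℝ K) (hTK : MapsTo T K K)
    (h12 : IsStrongPseudocontractiveOn k T K)
    (h3 : ∀ ⦃x⦄, x ∈ K → ∀ ⦃y⦄, y ∈ K → ‖T x - T y‖ ≤ L * ‖x - y‖) (hL : 0 ≤ L) (hk1 : k ≤ 1)
    (hx : x ∈ K) (hp : p ∈ K) (hTp : T p = p) (ha0 : 0 < a) (ha1 : a ≤ 1) :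
    ‖mannStep T a x - p‖ ≤ spcFactor k L a * ‖x - p‖ := by
  have h := norm_mannStep_sub_le_spc hK hTK h12 h3 hL hk1 hx hp hTp ha0 ha1
  have ha1' : 0 < 1 + a := by linarith
  rw [spcFactor, div_mul_eq_mul_div, le_div_iff₀ ha1']
  linarith

/-- `β_n ≥ (η/(1+k)) α_n`, i.e. `A_n/B_n ≤ 1 − (η/(1+k)) α_n`, when
`0 ≤ α_n ≤ (k − η)/((L+1)(L+2−k))`, `0 < η`, `k ≤ 1`, `L ≥ 0`.
[cite: Berinde2007, Ch. 4 §4.3, Thm. 4.12 (proof)] -/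
theorem spcFactor_le_one_sub (hk1 : k ≤ 1) (hL : 0 ≤ L) (hη0 : 0 < η) (ha0 : 0 ≤ a)
    (hab : a ≤ (k - η) / ((L + 1) * (L + 2 - k))) :
    spcFactor k L a ≤ 1 - η / (1 + k) * a := by
  set D := (L + 1) * (L + 2 - k) with hD
  have hD1 : 1 ≤ D := by rw [hD]; nlinarith
  have hD0 : 0 < D := by linarith
  have h1 : a * D ≤ k - η := (le_div_iff₀ hD0).1 hab
  have hak : a ≤ k := by nlinarith
  have h3 : a / (1 + k) ≤ a / (1 + a) :=
    div_le_div_of_nonneg_left ha0 (by linarith) (by linarith)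
  have h4 : η / (1 + k) * a ≤ 1 - spcFactor k L a := by
    calc η / (1 + k) * a = η * (a / (1 + k)) := by ring
      _ ≤ η * (a / (1 + a)) := mul_le_mul_of_nonneg_left h3 hη0.le
      _ ≤ (k - D * a) * (a / (1 + a)) :=
          mul_le_mul_of_nonneg_right (by linarith) (div_nonneg ha0 (by linarith))
      _ = 1 - spcFactor k L a := by rw [one_sub_spcFactor ha0, hD]; ring
  linarith

/-- `A/B ≤ 1 − k a + (3 + 3L + L²) a²` for `a, k, L ≥ 0` (the estimate used for Corollary 4.2).
[cite: Berinde2007, Ch. 4 §4.3, Cor. 4.2 (proof)] -/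
theorem spcFactor_le_quad (hk0 : 0 ≤ k) (hL : 0 ≤ L) (ha0 : 0 ≤ a) :
    spcFactor k L a ≤ 1 - k * a + (3 + 3 * L + L ^ 2) * a ^ 2 := by
  have ha1' : 0 < 1 + a := by linarith
  rw [spcFactor, div_le_iff₀ ha1']
  have e1 : 0 ≤ k * L * a ^ 2 := by positivity
  have e2 : 0 ≤ (3 + 3 * L + L ^ 2) * a ^ 3 := by positivity
  nlinarith [e1, e2]

/-! ## The recurrent inequality (Lemma 1.2 in the form used here) -/

/-- If `0 ≤ δ_{n+1} ≤ (1 − c a_n) δ_n` then `δ_n ≤ δ_0 exp(−c Σ_{j<n} a_j)`.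
[cite: Berinde2007, Ch. 1 §1.3, Lemma 1.2] -/
theorem le_mul_exp_neg_of_succ_le {δ a : ℕ → ℝ} {c : ℝ} (hδ : ∀ n, 0 ≤ δ n)
    (hstep : ∀ n, δ (n + 1) ≤ (1 - c * a n) * δ n) (n : ℕ) :
    δ n ≤ δ 0 * Real.exp (-(c * ∑ j ∈ range n, a j)) := by
  induction n with
  | zero => simp
  | succ n ih =>
    calc δ (n + 1) ≤ (1 - c * a n) * δ n := hstep n
      _ ≤ Real.exp (-(c * a n)) * δ n :=
          mul_le_mul_of_nonneg_right (Real.one_sub_le_exp_neg _) (hδ n)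
      _ ≤ Real.exp (-(c * a n)) * (δ 0 * Real.exp (-(c * ∑ j ∈ range n, a j))) :=
          mul_le_mul_of_nonneg_left ih (Real.exp_nonneg _)
      _ = δ 0 * Real.exp (-(c * ∑ j ∈ range (n + 1), a j)) := by
          rw [sum_range_succ, mul_add, neg_add, Real.exp_add]; ring

/-- **Lemma 1.2 (the case used in §4.3)**: `0 ≤ δ_{n+1} ≤ (1 − c a_n) δ_n`, `c > 0`, `Σ a_n = ∞`
⟹ `δ_n → 0`. [cite: Berinde2007, Ch. 1 §1.3, Lemma 1.2] -/
theorem tendsto_zero_of_succ_le_one_sub_mul {δ a : ℕ → ℝ} {c : ℝ} (hδ : ∀ n, 0 ≤ δ n)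
    (hstep : ∀ n, δ (n + 1) ≤ (1 - c * a n) * δ n) (hc : 0 < c)
    (ha : Tendsto (fun n => ∑ j ∈ range n, a j) atTop atTop) : Tendsto δ atTop (𝓝 0) := by
  have hlim : Tendsto (fun n => δ 0 * Real.exp (-(c * ∑ j ∈ range n, a j))) atTop (𝓝 0) := by
    rw [← mul_zero (δ 0)]
    exact tendsto_const_nhds.mul
      (Real.tendsto_exp_atBot.comp (tendsto_neg_atTop_atBot.comp (ha.const_mul_atTop hc)))
  exact tendsto_of_tendsto_of_tendsto_of_le_of_le tendsto_const_nhds hlim hδ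
    (le_mul_exp_neg_of_succ_le hδ hstep)

/-- Tail version: the contraction need only hold for `n ≥ N`.
[cite: Berinde2007, Ch. 1 §1.3, Lemma 1.2] -/
theorem tendsto_zero_of_succ_le_one_sub_mul_of_le {δ a : ℕ → ℝ} {c : ℝ} {N : ℕ} (hδ : ∀ n, 0 ≤ δ n)
    (hstep : ∀ n ≥ N, δ (n + 1) ≤ (1 - c * a n) * δ n) (hc : 0 < c)
    (ha : Tendsto (fun n => ∑ j ∈ range n, a j) atTop atTop) : Tendsto δ atTop (𝓝 0) := by
  have h1 : Tendsto (fun n => δ (N + n)) atTop (𝓝 0) := by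
    refine tendsto_zero_of_succ_le_one_sub_mul (a := fun n => a (N + n)) (fun n => hδ _)
      (fun n => ?_) hc ?_
    · exact hstep (N + n) (Nat.le_add_right N n)
    · have e : ∀ n, ∑ j ∈ range n, a (N + j)
          = (∑ j ∈ range (N + n), a j) + (-(∑ j ∈ range N, a j)) := by
        intro n; rw [sum_range_add]; ring
      have h' : Tendsto (fun n => ∑ j ∈ range (N + n), a j) atTop atTop :=
        ha.comp ((tendsto_add_atTop_nat N).congr (fun n => Nat.add_comm n N))
      simp_rw [e]
      exact tendsto_atTop_add_const_right _ _ h'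
  rw [← tendsto_add_atTop_iff_nat N]
  exact h1.congr (fun n => by rw [Nat.add_comm])

/-! ## The orbit estimates and Theorems 4.11, 4.12 -/

/-- (17) along the Mann iteration: `‖x_{n+1} − p‖ ≤ (A_n/B_n) ‖x_n − p‖`.
[cite: Berinde2007, Ch. 4 §4.3, Thm. 4.12 (17)] -/
theorem norm_mannIter_succ_sub_le_spc (hK : Convex ℝ K) (hTK : MapsTo T K K)
    (h12 : IsStrongPseudocontractiveOn k T K)
    (h3 : ∀ ⦃x⦄, x ∈ K → ∀ ⦃y⦄, y ∈ K → ‖T x - T y‖ ≤ L * ‖x - y‖) (hL : 0 ≤ L) (hk1 : k ≤ 1)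
    (hp : p ∈ K) (hTp : T p = p) (hα : ∀ n, 0 < α n ∧ α n ≤ 1) (hx₀ : x₀ ∈ K) (n : ℕ) :
    ‖mannIter T α x₀ (n + 1) - p‖ ≤ spcFactor k L (α n) * ‖mannIter T α x₀ n - p‖ := by
  rw [mannIter_succ]
  exact norm_mannStep_sub_le_spcFactor hK hTK h12 h3 hL hk1
    (mannIter_mem hK hTK hx₀ (fun n => ⟨(hα n).1.le, (hα n).2⟩) n) hp hTp (hα n).1 (hα n).2

/-- The product estimate of Theorem 4.12: `‖x_n − p‖ ≤ ∏_{j<n} (A_j/B_j) · ‖x_0 − p‖`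
(`= ∏ (1 − β_j) ‖x_0 − p‖`). [cite: Berinde2007, Ch. 4 §4.3, Thm. 4.12] -/
theorem norm_mannIter_sub_le_prod_spc (hK : Convex ℝ K) (hTK : MapsTo T K K)
    (h12 : IsStrongPseudocontractiveOn k T K)
    (h3 : ∀ ⦃x⦄, x ∈ K → ∀ ⦃y⦄, y ∈ K → ‖T x - T y‖ ≤ L * ‖x - y‖) (hL : 0 ≤ L) (hk1 : k ≤ 1)
    (hp : p ∈ K) (hTp : T p = p) (hα : ∀ n, 0 < α n ∧ α n ≤ 1) (hx₀ : x₀ ∈ K) (n : ℕ) :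
    ‖mannIter T α x₀ n - p‖ ≤ (∏ j ∈ range n, spcFactor k L (α j)) * ‖x₀ - p‖ := by
  induction n with
  | zero => simp
  | succ n ih =>
    calc ‖mannIter T α x₀ (n + 1) - p‖ ≤ spcFactor k L (α n) * ‖mannIter T α x₀ n - p‖ :=
          norm_mannIter_succ_sub_le_spc hK hTK h12 h3 hL hk1 hp hTp hα hx₀ n
      _ ≤ spcFactor k L (α n) * ((∏ j ∈ range n, spcFactor k L (α j)) * ‖x₀ - p‖) :=
          mul_le_mul_of_nonneg_left ih (spcFactor_pos hk1 hL (hα n).1.le).le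
      _ = _ := by rw [prod_range_succ]; ring

/-- **Theorem 4.12 (Berinde).** `E` a real normed space, `K ⊆ E` convex, `T(K) ⊆ K`, `T`
`L`-Lipschitzian and `k`-strongly pseudocontractive on `K` (`0 < k < 1`), `p = T p ∈ K`.  If
`α_n ∈ (0,1]`, `Σ α_n = ∞` and `α_n ≤ (k − η)/((L+1)(L+2−k))` for some `η ∈ (0,k)`, then the Mann
iteration converges (strongly) to `p` for every `x₀ ∈ K`.  (The estimate is
`norm_mannIter_sub_le_prod_spc` with `spcFactor_le_one_sub`.) [cite: Berinde2007, Ch. 4 §4.3, Thm. 4.12] -/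
theorem tendsto_mannIter_spc (hK : Convex ℝ K) (hTK : MapsTo T K K)
    (h12 : IsStrongPseudocontractiveOn k T K)
    (h3 : ∀ ⦃x⦄, x ∈ K → ∀ ⦃y⦄, y ∈ K → ‖T x - T y‖ ≤ L * ‖x - y‖) (hL : 0 ≤ L)
    (hk1 : k < 1) (hp : p ∈ K) (hTp : T p = p) (hα : ∀ n, 0 < α n ∧ α n ≤ 1)
    (hdiv : Tendsto (fun n => ∑ j ∈ range n, α j) atTop atTop) (hη0 : 0 < η) (hηk : η < k)
    (hαb : ∀ n, α n ≤ (k - η) / ((L + 1) * (L + 2 - k))) (hx₀ : x₀ ∈ K) :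
    Tendsto (mannIter T α x₀) atTop (𝓝 p) := by
  rw [tendsto_iff_norm_sub_tendsto_zero]
  have hk0 : 0 < k := hη0.trans hηk
  refine tendsto_zero_of_succ_le_one_sub_mul (c := η / (1 + k)) (a := α) (fun n => norm_nonneg _)
    (fun n => ?_) (div_pos hη0 (by linarith)) hdiv
  calc ‖mannIter T α x₀ (n + 1) - p‖ ≤ spcFactor k L (α n) * ‖mannIter T α x₀ n - p‖ :=
        norm_mannIter_succ_sub_le_spc hK hTK h12 h3 hL hk1.le hp hTp hα hx₀ n
    _ ≤ (1 - η / (1 + k) * α n) * ‖mannIter T α x₀ n - p‖ :=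
        mul_le_mul_of_nonneg_right
          (spcFactor_le_one_sub hk1.le hL hη0 (hα n).1.le (hαb n)) (norm_nonneg _)

/-- **Theorem 4.11.** `E` a real normed space, `K ⊆ E` convex, `T(K) ⊆ K`, `T` `L`-Lipschitzian and
`k`-strongly pseudocontractive on `K` (`0 < k < 1`), `p = T p ∈ K`.  If `α_n ∈ (0,1]`,
(i) `Σ α_n = ∞` and (ii) `α_n → 0`, then the Mann iteration converges (strongly) to `p`, the unique
fixed point of `T`, for every `x₀ ∈ K`.  (Boundedness of `K` is not used.)
[cite: Berinde2007, Ch. 4 §4.3, Thm. 4.11] -/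
theorem tendsto_mannIter_spc_of_tendsto_zero (hK : Convex ℝ K) (hTK : MapsTo T K K)
    (h12 : IsStrongPseudocontractiveOn k T K)
    (h3 : ∀ ⦃x⦄, x ∈ K → ∀ ⦃y⦄, y ∈ K → ‖T x - T y‖ ≤ L * ‖x - y‖) (hL : 0 ≤ L)
    (hk0 : 0 < k) (hk1 : k < 1) (hp : p ∈ K) (hTp : T p = p) (hα : ∀ n, 0 < α n ∧ α n ≤ 1)
    (hdiv : Tendsto (fun n => ∑ j ∈ range n, α j) atTop atTop)
    (hα0 : Tendsto α atTop (𝓝 0)) (hx₀ : x₀ ∈ K) :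
    Tendsto (mannIter T α x₀) atTop (𝓝 p) := by
  rw [tendsto_iff_norm_sub_tendsto_zero]
  -- eventually `α_n ≤ (k − k/2)/((L+1)(L+2−k))`
  have hb : 0 < (k - k / 2) / ((L + 1) * (L + 2 - k)) :=
    div_pos (by linarith) (mul_pos (by linarith) (by linarith))
  obtain ⟨N, hN⟩ := eventually_atTop.1 ((tendsto_order.1 hα0).2 _ hb)
  refine tendsto_zero_of_succ_le_one_sub_mul_of_le (N := N) (c := (k / 2) / (1 + k)) (a := α)
    (fun n => norm_nonneg _) (fun n hn => ?_) (div_pos (by linarith) (by linarith)) hdiv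
  have hαn : α n ≤ (k - k / 2) / ((L + 1) * (L + 2 - k)) := (hN n hn).le
  calc ‖mannIter T α x₀ (n + 1) - p‖ ≤ spcFactor k L (α n) * ‖mannIter T α x₀ n - p‖ :=
        norm_mannIter_succ_sub_le_spc hK hTK h12 h3 hL hk1.le hp hTp hα hx₀ n
    _ ≤ (1 - (k / 2) / (1 + k) * α n) * ‖mannIter T α x₀ n - p‖ :=
        mul_le_mul_of_nonneg_right
          (spcFactor_le_one_sub hk1.le hL (by linarith) (hα n).1.le hαn) (norm_nonneg _)

/-! ## Constant sequences: Corollaries 4.2 and 4.3 (Krasnoselskij iteration) -/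

/-- From `δ_{n+1} ≤ ρ δ_n` (`ρ ≥ 0`) to `δ_n ≤ ρ^n δ_0`. [cite: Berinde2007, Ch. 4 §4.3, Cor. 4.2] -/
theorem le_pow_mul_of_succ_le_mul {δ : ℕ → ℝ} {ρ : ℝ} (hρ : 0 ≤ ρ)
    (hstep : ∀ n, δ (n + 1) ≤ ρ * δ n) (n : ℕ) : δ n ≤ ρ ^ n * δ 0 := by
  induction n with
  | zero => simp
  | succ n ih =>
    calc δ (n + 1) ≤ ρ * δ n := hstep n
      _ ≤ ρ * (ρ ^ n * δ 0) := mul_le_mul_of_nonneg_left ih hρ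
      _ = _ := by ring

/-- **Corollary 4.2.** With the constant sequence `α_n ≡ k/(2(3 + 3L + L²))` (`0 < k < 1`, `L ≥ 0`)
the Mann iteration satisfies `‖x_n − p‖ ≤ ρ^n ‖x_0 − p‖`, `ρ = 1 − k²/(4(3 + 3L + L²))`.
[cite: Berinde2007, Ch. 4 §4.3, Cor. 4.2] -/
theorem norm_mannIter_sub_le_pow_cor42 (hK : Convex ℝ K) (hTK : MapsTo T K K)
    (h12 : IsStrongPseudocontractiveOn k T K)
    (h3 : ∀ ⦃x⦄, x ∈ K → ∀ ⦃y⦄, y ∈ K → ‖T x - T y‖ ≤ L * ‖x - y‖) (hL : 0 ≤ L)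
    (hk0 : 0 < k) (hk1 : k < 1) (hp : p ∈ K) (hTp : T p = p) (hx₀ : x₀ ∈ K) (n : ℕ) :
    ‖mannIter T (fun _ => k / (2 * (3 + 3 * L + L ^ 2))) x₀ n - p‖
      ≤ (1 - k ^ 2 / (4 * (3 + 3 * L + L ^ 2))) ^ n * ‖x₀ - p‖ := by
  set M := 3 + 3 * L + L ^ 2 with hM
  have hM0 : 3 ≤ M := by rw [hM]; nlinarith
  set a := k / (2 * M) with ha
  have ha0 : 0 < a := div_pos hk0 (by linarith)
  have ha1 : a ≤ 1 := by
    rw [ha, div_le_one (by linarith)]; nlinarith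
  have hρ : spcFactor k L a ≤ 1 - k ^ 2 / (4 * M) := by
    have h := spcFactor_le_quad (k := k) (L := L) hk0.le hL ha0.le
    have e : 1 - k * a + (3 + 3 * L + L ^ 2) * a ^ 2 = 1 - k ^ 2 / (4 * M) := by
      rw [← hM, ha]; field_simp; ring
    linarith
  have hρ0 : 0 ≤ 1 - k ^ 2 / (4 * M) := by
    rw [sub_nonneg, div_le_one (by linarith)]; nlinarith
  refine le_pow_mul_of_succ_le_mul (δ := fun n => ‖mannIter T (fun _ => a) x₀ n - p‖) hρ0
    (fun m => ?_) n
  calc ‖mannIter T (fun _ => a) x₀ (m + 1) - p‖ ≤ spcFactor k L a * ‖mannIter T (fun _ => a) x₀ m - p‖ :=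
        norm_mannIter_succ_sub_le_spc hK hTK h12 h3 hL hk1.le hp hTp (fun _ => ⟨ha0, ha1⟩) hx₀ m
    _ ≤ (1 - k ^ 2 / (4 * M)) * ‖mannIter T (fun _ => a) x₀ m - p‖ :=
        mul_le_mul_of_nonneg_right hρ (norm_nonneg _)

/-- **Corollary 4.3 (estimate).** For the Krasnoselskij iteration (`α_n ≡ λ`, `0 < λ ≤ 1`):
`‖x_n − p‖ ≤ q^n ‖x_0 − p‖` with `q = (1 + (1 − k)λ + (L+1)(L+2−k)λ²)/(1 + λ)`.
[cite: Berinde2007, Ch. 4 §4.3, Cor. 4.3] -/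
theorem norm_mannIter_sub_le_pow_cor43 (hK : Convex ℝ K) (hTK : MapsTo T K K)
    (h12 : IsStrongPseudocontractiveOn k T K)
    (h3 : ∀ ⦃x⦄, x ∈ K → ∀ ⦃y⦄, y ∈ K → ‖T x - T y‖ ≤ L * ‖x - y‖) (hL : 0 ≤ L) (hk1 : k ≤ 1)
    (hp : p ∈ K) (hTp : T p = p) (ht0 : 0 < t) (ht1 : t ≤ 1) (hx₀ : x₀ ∈ K) (n : ℕ) :
    ‖mannIter T (fun _ => t) x₀ n - p‖ ≤ spcFactor k L t ^ n * ‖x₀ - p‖ :=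
  le_pow_mul_of_succ_le_mul (δ := fun n => ‖mannIter T (fun _ => t) x₀ n - p‖)
    (spcFactor_pos hk1 hL ht0.le).le
    (fun m => norm_mannIter_succ_sub_le_spc hK hTK h12 h3 hL hk1 hp hTp (fun _ => ⟨ht0, ht1⟩) hx₀ m)
    n

/-- `q = A/B < 1` when `0 < λ < a = k/((L+1)(L+2−k))` (`k ≤ 1`, `L ≥ 0`).
[cite: Berinde2007, Ch. 4 §4.3, Cor. 4.3] -/
theorem spcFactor_lt_one (hk1 : k ≤ 1) (hL : 0 ≤ L) (ht0 : 0 < t)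
    (hta : t < k / ((L + 1) * (L + 2 - k))) : spcFactor k L t < 1 := by
  have hD0 : 0 < (L + 1) * (L + 2 - k) := mul_pos (by linarith) (by linarith)
  have h1 : t * ((L + 1) * (L + 2 - k)) < k := (lt_div_iff₀ hD0).1 hta
  have h2 : 0 < 1 - spcFactor k L t := by
    rw [one_sub_spcFactor ht0.le]
    exact mul_pos (div_pos ht0 (by linarith)) (by linarith)
  linarith

/-- **Corollary 4.3 (convergence).** `E` a real normed space, `K` convex, `T(K) ⊆ K`, `T`
`L`-Lipschitzian and `k`-strongly pseudocontractive on `K` (`0 < k < 1`), `p = T p ∈ K`; for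
`0 < λ < k/((L+1)(L+2−k))` the Krasnoselskij iteration `x_{n+1} = (1 − λ) x_n + λ T x_n` converges to
`p`. [cite: Berinde2007, Ch. 4 §4.3, Cor. 4.3] -/
theorem tendsto_mannIter_cor43 (hK : Convex ℝ K) (hTK : MapsTo T K K)
    (h12 : IsStrongPseudocontractiveOn k T K)
    (h3 : ∀ ⦃x⦄, x ∈ K → ∀ ⦃y⦄, y ∈ K → ‖T x - T y‖ ≤ L * ‖x - y‖) (hL : 0 ≤ L)
    (hk1 : k < 1) (hp : p ∈ K) (hTp : T p = p) (ht0 : 0 < t)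
    (hta : t < k / ((L + 1) * (L + 2 - k))) (hx₀ : x₀ ∈ K) :
    Tendsto (mannIter T (fun _ => t) x₀) atTop (𝓝 p) := by
  have hD1 : 1 ≤ (L + 1) * (L + 2 - k) := by nlinarith
  have ht1 : t ≤ 1 := by
    have h1 : t * ((L + 1) * (L + 2 - k)) < k := (lt_div_iff₀ (by linarith)).1 hta
    nlinarith
  rw [tendsto_iff_norm_sub_tendsto_zero]
  have hq0 := (spcFactor_pos hk1.le hL ht0.le).le
  have hq1 := spcFactor_lt_one hk1.le hL ht0 hta
  have hlim : Tendsto (fun n => spcFactor k L t ^ n * ‖x₀ - p‖) atTop (𝓝 0) := by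
    rw [← zero_mul ‖x₀ - p‖]
    exact (tendsto_pow_atTop_nhds_zero_of_lt_one hq0 hq1).mul tendsto_const_nhds
  exact tendsto_of_tendsto_of_tendsto_of_le_of_le tendsto_const_nhds hlim (fun n => norm_nonneg _)
    (norm_mannIter_sub_le_pow_cor43 hK hTK h12 h3 hL hk1.le hp hTp ht0 ht1 hx₀)

/-! ## Theorem 9.8 (Ch. 9 §9.5): the fastest Krasnoselskij iteration -/

/-- Partial-fraction form of the factor: with `C = (L+1)(L+2−k)`,
`q(λ) = C λ + (1 − k − C) + (C + k)/(1 + λ)` (`λ ≥ 0`).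
[cite: Berinde2007, Ch. 9 §9.5, Thm. 9.8 (proof)] -/
theorem spcFactor_eq_affine_add_div (ht : 0 ≤ t) :
    spcFactor k L t = (L + 1) * (L + 2 - k) * t + (1 - k - (L + 1) * (L + 2 - k))
      + ((L + 1) * (L + 2 - k) + k) / (1 + t) := by
  unfold spcFactor
  have : (1 + t) ≠ 0 := by positivity
  field_simp
  ring

/-- Berinde's optimal Krasnoselskij step `λ₀ = −1 + √(1 + a)`, `a = k/((L+1)(L+2−k))`, the root in
`(0, a)` of `λ² + 2λ − a = 0` (`⟺ q'(λ) = 0`). [cite: Berinde2007, Ch. 9 §9.5, Thm. 9.8] -/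
noncomputable def spcOptimalStep (k L : ℝ) : ℝ := -1 + Real.sqrt (1 + k / ((L + 1) * (L + 2 - k)))

/-- `(1 + λ₀)² = 1 + a`. [cite: Berinde2007, Ch. 9 §9.5, Thm. 9.8 (proof)] -/
theorem one_add_spcOptimalStep_sq (hk0 : 0 ≤ k) (hk1 : k ≤ 1) (hL : 0 ≤ L) :
    (1 + spcOptimalStep k L) ^ 2 = 1 + k / ((L + 1) * (L + 2 - k)) := by
  have hD0 : 0 < (L + 1) * (L + 2 - k) := mul_pos (by linarith) (by linarith)
  have ha : 0 ≤ 1 + k / ((L + 1) * (L + 2 - k)) := by positivity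
  simp only [spcOptimalStep, add_neg_cancel_left]
  exact Real.sq_sqrt ha

/-- `λ₀² + 2 λ₀ − a = 0`, i.e. `q'(λ₀) = 0`. [cite: Berinde2007, Ch. 9 §9.5, Thm. 9.8 (proof)] -/
theorem spcOptimalStep_quadratic (hk0 : 0 ≤ k) (hk1 : k ≤ 1) (hL : 0 ≤ L) :
    spcOptimalStep k L ^ 2 + 2 * spcOptimalStep k L - k / ((L + 1) * (L + 2 - k)) = 0 := by
  have := one_add_spcOptimalStep_sq hk0 hk1 hL
  nlinarith [this]

/-- `0 < λ₀` when `0 < k ≤ 1`, `L ≥ 0`. [cite: Berinde2007, Ch. 9 §9.5, Thm. 9.8] -/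
theorem spcOptimalStep_pos (hk0 : 0 < k) (hk1 : k ≤ 1) (hL : 0 ≤ L) : 0 < spcOptimalStep k L := by
  have hD0 : 0 < (L + 1) * (L + 2 - k) := mul_pos (by linarith) (by linarith)
  have ha : 1 < 1 + k / ((L + 1) * (L + 2 - k)) := by
    have : 0 < k / ((L + 1) * (L + 2 - k)) := div_pos hk0 hD0
    linarith
  unfold spcOptimalStep
  have : 1 < Real.sqrt (1 + k / ((L + 1) * (L + 2 - k))) := by
    have h := Real.sqrt_lt_sqrt zero_le_one ha
    rwa [Real.sqrt_one] at h
  linarith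

/-- `λ₀ < a = k/((L+1)(L+2−k))`: the optimal step lies in Corollary 4.3's admissible interval
`(0, a)`. [cite: Berinde2007, Ch. 9 §9.5, Thm. 9.8] -/
theorem spcOptimalStep_lt (hk0 : 0 < k) (hk1 : k ≤ 1) (hL : 0 ≤ L) :
    spcOptimalStep k L < k / ((L + 1) * (L + 2 - k)) := by
  have h0 := spcOptimalStep_pos hk0 hk1 hL
  have hq := spcOptimalStep_quadratic hk0.le hk1 hL
  nlinarith [h0, hq, sq_nonneg (spcOptimalStep k L)]

/-- The key identity of Theorem 9.8: `q(λ) − q(λ₀) = C (λ − λ₀)²/(1 + λ)` for `λ ≥ 0`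
(`C = (L+1)(L+2−k)`), so `λ₀` is the unique minimiser of `q` on `[0, ∞)`.
[cite: Berinde2007, Ch. 9 §9.5, Thm. 9.8 (proof)] -/
theorem spcFactor_sub_spcFactor_optimal (hk0 : 0 ≤ k) (hk1 : k ≤ 1) (hL : 0 ≤ L) (ht : 0 ≤ t) :
    spcFactor k L t - spcFactor k L (spcOptimalStep k L)
      = (L + 1) * (L + 2 - k) * (t - spcOptimalStep k L) ^ 2 / (1 + t) := by
  have hD0 : 0 < (L + 1) * (L + 2 - k) := mul_pos (by linarith) (by linarith)
  have h0 : 0 ≤ spcOptimalStep k L := by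
    rcases hk0.eq_or_lt with h | h
    · simp [spcOptimalStep, ← h]
    · exact (spcOptimalStep_pos h hk1 hL).le
  set l := spcOptimalStep k L with hl
  have hsq : (L + 1) * (L + 2 - k) * (1 + l) ^ 2 = (L + 1) * (L + 2 - k) + k := by
    rw [hl, one_add_spcOptimalStep_sq hk0 hk1 hL, mul_add, mul_one, mul_div_cancel₀ _ hD0.ne']
  rw [spcFactor_eq_affine_add_div ht, spcFactor_eq_affine_add_div h0, ← hsq]
  have h1 : (1 + t) ≠ 0 := by positivity
  have h2 : (1 + l) ≠ 0 := by positivity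
  field_simp
  ring

/-- `q(λ₀) ≤ q(λ)` for every `λ ≥ 0`. [cite: Berinde2007, Ch. 9 §9.5, Thm. 9.8] -/
theorem spcFactor_optimal_le (hk0 : 0 ≤ k) (hk1 : k ≤ 1) (hL : 0 ≤ L) (ht : 0 ≤ t) :
    spcFactor k L (spcOptimalStep k L) ≤ spcFactor k L t := by
  have h := spcFactor_sub_spcFactor_optimal hk0 hk1 hL ht
  have : 0 ≤ (L + 1) * (L + 2 - k) * (t - spcOptimalStep k L) ^ 2 / (1 + t) := by
    have : 0 ≤ (L + 1) * (L + 2 - k) := mul_nonneg (by linarith) (by linarith)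
    positivity
  linarith

/-- `q(λ₀) < q(λ)` for every `λ ≥ 0`, `λ ≠ λ₀`. [cite: Berinde2007, Ch. 9 §9.5, Thm. 9.8] -/
theorem spcFactor_optimal_lt (hk0 : 0 ≤ k) (hk1 : k ≤ 1) (hL : 0 ≤ L) (ht : 0 ≤ t)
    (hne : t ≠ spcOptimalStep k L) :
    spcFactor k L (spcOptimalStep k L) < spcFactor k L t := by
  have h := spcFactor_sub_spcFactor_optimal hk0 hk1 hL ht
  have : 0 < (L + 1) * (L + 2 - k) * (t - spcOptimalStep k L) ^ 2 / (1 + t) := by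
    have h1 : 0 < (L + 1) * (L + 2 - k) := mul_pos (by linarith) (by linarith)
    have h2 : 0 < (t - spcOptimalStep k L) ^ 2 := by positivity
    positivity
  linarith

/-- **Theorem 9.8 (the fastest Krasnoselskij iteration).** For `0 < k ≤ 1`, `L ≥ 0` and any
admissible `λ ≥ 0`, `λ ≠ λ₀`: `(q(λ₀)/q(λ))ⁿ → 0`, i.e. the a priori estimate
`‖x_n^{λ₀} − p‖ ≤ q(λ₀)ⁿ ‖x₀ − p‖` of Corollary 4.3 converges faster (Definition 9.2) than the estimate
`q(λ)ⁿ ‖x₀ − p‖` of any other Krasnoselskij iteration of the family.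
[cite: Berinde2007, Ch. 9 §9.5, Thm. 9.8] -/
theorem tendsto_pow_spcFactor_optimal_div (hk0 : 0 < k) (hk1 : k ≤ 1) (hL : 0 ≤ L) (ht : 0 ≤ t)
    (hne : t ≠ spcOptimalStep k L) :
    Tendsto (fun n => (spcFactor k L (spcOptimalStep k L) / spcFactor k L t) ^ n) atTop (𝓝 0) := by
  have hq0 : 0 < spcFactor k L (spcOptimalStep k L) :=
    spcFactor_pos hk1 hL (spcOptimalStep_pos hk0 hk1 hL).le
  have hqt : 0 < spcFactor k L t := spcFactor_pos hk1 hL ht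
  have hlt := spcFactor_optimal_lt hk0.le hk1 hL ht hne
  exact tendsto_pow_atTop_nhds_zero_of_lt_one (div_pos hq0 hqt).le ((div_lt_one hqt).2 hlt)

/-- Theorem 9.8, convergence clause: the Krasnoselskij iteration with the optimal step `λ₀`
converges to the fixed point (Corollary 4.3 applies since `λ₀ ∈ (0, a)`).
[cite: Berinde2007, Ch. 9 §9.5, Thm. 9.8] -/
theorem tendsto_mannIter_optimalStep (hK : Convex ℝ K) (hTK : MapsTo T K K)
    (h12 : IsStrongPseudocontractiveOn k T K)
    (h3 : ∀ ⦃x⦄, x ∈ K → ∀ ⦃y⦄, y ∈ K → ‖T x - T y‖ ≤ L * ‖x - y‖) (hL : 0 ≤ L)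
    (hk0 : 0 < k) (hk1 : k < 1) (hp : p ∈ K) (hTp : T p = p) (hx₀ : x₀ ∈ K) :
    Tendsto (mannIter T (fun _ => spcOptimalStep k L) x₀) atTop (𝓝 p) :=
  tendsto_mannIter_cor43 hK hTK h12 h3 hL hk1 hp hTp (spcOptimalStep_pos hk0 hk1.le hL)
    (spcOptimalStep_lt hk0 hk1.le hL) hx₀

/-! ## Example 4.3 -/

/-- **Example 4.3 (b).** `T x = 1/x` on `K = [1/2, 2] ⊂ ℝ` is strongly pseudocontractive in the form
(12'') with every constant `k ≤ 1` (hence with any `k ∈ (0,1)`):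
`x − y + r[(1−k)x − 1/x − (1−k)y + 1/y] = (x − y)(1 + r(1−k) + r/(xy))`.
[cite: Berinde2007, Ch. 4 §4.3, Example 4.3] -/
theorem example43_isStrongPseudocontractiveOn (hk : k ≤ 1) :
    IsStrongPseudocontractiveOn k (fun x : ℝ => x⁻¹) (Icc (1 / 2) 2) := by
  intro x hx y hy r hr
  have hx0 : 0 < x := by linarith [hx.1]
  have hy0 : 0 < y := by linarith [hy.1]
  have e : (x - y) + r • (((1 - k) • x - x⁻¹) - ((1 - k) • y - y⁻¹))
      = (x - y) * (1 + r * (1 - k) + r / (x * y)) := by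
    simp only [smul_eq_mul]
    field_simp
    ring
  rw [e, Real.norm_eq_abs, Real.norm_eq_abs, abs_mul]
  refine le_mul_of_one_le_right (abs_nonneg _) (le_trans ?_ (le_abs_self _))
  have : 0 ≤ r * (1 - k) := mul_nonneg hr.le (by linarith)
  have : 0 < r / (x * y) := div_pos hr (mul_pos hx0 hy0)
  linarith

/-- **Example 4.3 (a).** `T x = 1/x` is `4`-Lipschitzian on `[1/2, 2]`.
[cite: Berinde2007, Ch. 4 §4.3, Example 4.3] -/
theorem example43_lipschitz ⦃x : ℝ⦄ (hx : x ∈ Icc (1 / 2 : ℝ) 2) ⦃y : ℝ⦄ (hy : y ∈ Icc (1 / 2 : ℝ) 2) :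
    ‖x⁻¹ - y⁻¹‖ ≤ 4 * ‖x - y‖ := by
  have hx0 : 0 < x := by linarith [hx.1]
  have hy0 : 0 < y := by linarith [hy.1]
  have e : x⁻¹ - y⁻¹ = -(x - y) / (x * y) := by field_simp; ring
  rw [e, Real.norm_eq_abs, Real.norm_eq_abs, abs_div, abs_neg, abs_of_pos (mul_pos hx0 hy0),
    div_le_iff₀ (mul_pos hx0 hy0)]
  have hxy : 1 / 4 ≤ x * y := by nlinarith [hx.1, hy.1]
  nlinarith [abs_nonneg (x - y)]

/-- **Example 4.3 (c)–(d), via Corollary 4.3.** Although a constant sequence `α_n ≡ λ` violates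
(ii) of Theorem 4.11, the Krasnoselskij iteration of `T x = 1/x` on `[1/2, 2]` converges to the fixed
point `1` for every small `λ` (here: `0 < λ < k/(5(6 − k))` for some `k ∈ (0,1)`, from Corollary 4.3
with `L = 4`). [cite: Berinde2007, Ch. 4 §4.3, Example 4.3] -/
theorem example43_tendsto (hk0 : 0 < k) (hk1 : k < 1) (ht0 : 0 < t) (hta : t < k / (5 * (6 - k)))
    {x₀ : ℝ} (hx₀ : x₀ ∈ Icc (1 / 2 : ℝ) 2) :
    Tendsto (mannIter (fun x : ℝ => x⁻¹) (fun _ => t) x₀) atTop (𝓝 1) := by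
  have hK : Convex ℝ (Icc (1 / 2 : ℝ) 2) := convex_Icc _ _
  have hTK : MapsTo (fun x : ℝ => x⁻¹) (Icc (1 / 2 : ℝ) 2) (Icc (1 / 2 : ℝ) 2) := by
    intro x hx
    have hx0 : 0 < x := by linarith [hx.1]
    constructor
    · rw [le_inv_comm₀ (by norm_num) hx0]; norm_num; exact hx.2
    · rw [inv_le_comm₀ hx0 (by norm_num)]; linarith [hx.1]
  refine tendsto_mannIter_cor43 (L := 4) hK hTK (example43_isStrongPseudocontractiveOn hk1.le)
    (fun x hx y hy => example43_lipschitz hx hy) (by norm_num) hk1 (by norm_num) (by norm_num) ht0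
    ?_ hx₀
  convert hta using 2; ring

end Normed

/-! ## Hilbert-space dictionary: (12') ⟺ (12''), and the Krasnoselskij iteration of the tree -/

section Inner

variable {F : Type*} [NormedAddCommGroup F] [InnerProductSpace ℝ F]
variable {T : F → F} {K : Set F} {k : ℝ}

/-- **Kato's lemma in a real inner product space**: `‖a‖ ≤ ‖a + r b‖` for all `r > 0` iff
`⟪a, b⟫ ≥ 0`. [cite: Berinde2007, Ch. 1 Def. 1.13–1.14, Remarks 1)–2)] -/
theorem norm_le_norm_add_smul_iff_inner_nonneg (a b : F) :
    (∀ ⦃r : ℝ⦄, 0 < r → ‖a‖ ≤ ‖a + r • b‖) ↔ 0 ≤ ⟪a, b⟫ := by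
  have expand : ∀ r : ℝ, ‖a + r • b‖ ^ 2 = ‖a‖ ^ 2 + 2 * r * ⟪a, b⟫ + r ^ 2 * ‖b‖ ^ 2 := by
    intro r
    rw [← real_inner_self_eq_norm_sq, ← real_inner_self_eq_norm_sq, ← real_inner_self_eq_norm_sq,
      inner_add_left, inner_add_right, inner_add_right, inner_smul_left, inner_smul_right,
      inner_smul_left, inner_smul_right, real_inner_comm a b]
    simp only [conj_trivial]
    ring
  constructor
  · intro h
    by_contra hneg
    rw [not_le] at hneg
    -- take r = -⟪a,b⟫/(‖b‖²+1)
    set r := -⟪a, b⟫ / (‖b‖ ^ 2 + 1) with hr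
    have hr0 : 0 < r := div_pos (by linarith) (by positivity)
    have h1 := h hr0
    have h2 : ‖a‖ ^ 2 ≤ ‖a + r • b‖ ^ 2 := by gcongr
    rw [expand] at h2
    have h3 : r * (‖b‖ ^ 2 + 1) = -⟪a, b⟫ := by rw [hr]; field_simp
    nlinarith [sq_nonneg r, hr0]
  · intro h r hr
    have h2 : ‖a‖ ^ 2 ≤ ‖a + r • b‖ ^ 2 := by
      rw [expand]; nlinarith [sq_nonneg r, sq_nonneg ‖b‖]
    exact (pow_le_pow_iff_left₀ (norm_nonneg _) (norm_nonneg _) two_ne_zero).1 h2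

/-- In a real inner product space the Kato form (12'') is equivalent to (12')
`⟪(I − T)x − (I − T)y, x − y⟫ ≥ k ‖x − y‖²` ("T is strongly pseudocontractive iff I − T is strongly
accretive"). [cite: Berinde2007, Ch. 4 §4.3 (12')–(12''); Ch. 1 Def. 1.13–1.14] -/
theorem isStrongPseudocontractiveOn_iff_inner :
    IsStrongPseudocontractiveOn k T K ↔
      ∀ ⦃x⦄, x ∈ K → ∀ ⦃y⦄, y ∈ K → k * ‖x - y‖ ^ 2 ≤ ⟪(x - T x) - (y - T y), x - y⟫ := by
  have key : ∀ x y : F, (0 ≤ ⟪x - y, ((1 - k) • x - T x) - ((1 - k) • y - T y)⟫ ↔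
      k * ‖x - y‖ ^ 2 ≤ ⟪(x - T x) - (y - T y), x - y⟫) := by
    intro x y
    have e : ((1 - k) • x - T x) - ((1 - k) • y - T y) = ((x - T x) - (y - T y)) - k • (x - y) := by
      module
    rw [e, inner_sub_right, inner_smul_right, real_inner_self_eq_norm_sq, real_inner_comm, sub_nonneg]
  constructor
  · intro h x hx y hy
    exact (key x y).1 ((norm_le_norm_add_smul_iff_inner_nonneg _ _).1 (fun r hr => h hx hy hr))
  · intro h x hx y hy r hr
    exact (norm_le_norm_add_smul_iff_inner_nonneg _ _).2 ((key x y).2 (h hx hy)) hr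

/-- Dictionary: with a constant sequence `α_n ≡ λ` the Mann iteration is the Krasnoselskij iteration
`KrasnoselskijIteration.kmIter T λ x₀` of the tree (Corollary 4.3 is stated for it).
[cite: Berinde2007, Ch. 4 §4.3, Cor. 4.3 (18)] -/
theorem mannIter_const_eq_kmIter (T : F → F) (t : ℝ) (x₀ : F) (n : ℕ) :
    mannIter T (fun _ => t) x₀ n = kmIter T t x₀ n := by
  induction n with
  | zero => rfl
  | succ n ih => rw [mannIter_succ, kmIter_succ, ← ih]; rfl

end Inner

end Literature.Analysis.Convex.MannStrongPseudocontractions
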